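import Summits.AtomisticToContinuum.BoseEinsteinCondensation.Theses.BECPopovBerryRG
import Literature.MathematicalPhysics.QuantumManyBody.CondensateOccupationStability

/-!
# Birth skeleton (BC3) for the crux `PolarTransferOS` (stmt-AtomisticToContinuum-13937)

Route `BECPopovBerryRG` (sub-problem `BoseEinsteinCondensation`), crux of rank 4 — THE BET of the
route:

  `PolarTransferOS : BlockOccupationLD → BerryStiffPhaseOS → BlockPhaseCoherence`

(the volume-order large-deviation input for deficient blocks, and the OS-real stiff-phase ENGINE
`BerryStiffPhaseOS` = stmt-13936, together give uniform pairwise phase coherence `≥ cρℓ³` of all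
Fournais-scale blocks of every near-minimiser of the periodic `N`-body energy on the torus).

Registered by the skeleton registrar `planner-skel-stmt-AtomisticToContinuum-13937-0` (2026-08-17),
following the route's own TWO-LAYER PLAN ("PolarTransferOS ⇐ OffsetVillainRepresentation →
InsertionControl → PolarTransferOS") and the route-review note attached to the item (REVIEW-BEC.md,
refuter-rreview-0815T19-10-g2-0: "a polymer activity `e^{−K|F|}` for a UNION of slabs needs a joint
lower-tail / domination bound over families of blocks, which is NOT an instance of 14491 … expect a
child 'multi-slab domination'").

## The line (four registered stubs; `sorry` lives only in `stub_*`)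

* `stub_slabDomination : BlockOccupationLD → MultiSlabLD` — the single-block lower tail of the route
  (stmt-14491) upgraded to a JOINT lower tail for families `F` of blocks with rate additive in `|F|`
  (`≤ exp(−cρℓ³·|F|)`): exactly the large-field input `‖g_F‖ ≤ e^{−K|F|}` the engine asks for
  (the reviewer's "multi-slab domination"; size L).
* `stub_representation : MultiSlabLD → OffsetVillainRepresentation` — THE BET proper, typed as a
  DATA-EXISTENTIAL over the engine's class: for `Λ ≥ 1`, `R` of the representation's choice and
  every triple of engine constants `(ε₀, K₀, C)`, at every small density and every large `N` there is,
  at every energy slack `δ`, a `δ`-near-minimiser `Ψ` (the reference state: ground / thermal limit)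
  such that for every block number in the window and every pair of blocks `(z, z')` there are
  ADMISSIBLE engine data — stiffness `K ≥ K₀`, a space-time torus, bond factors with Gaussian core and
  Peierls floor, an `ε₀`-dominated OS-real `U(1)`-invariant range-`R` remainder, factorising OS-real
  large-field activities of norm `≤ e^{−K|F|}`, and two admissible OS-real insertions at equal time —
  for which the engine's output (`Z ≠ 0` and `‖∫cos(θ_x − θ_y)·O·P·wt − Z‖ ≤ (C/√K)‖Z‖`) implies the
  pair-coherence inequality `occ(φ_z + φ_z') ≥ occ(φ_z) + occ(φ_z') + 2cρℓ³` for `Ψ` (the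
  offset-Villain / number–phase representation of the blocked torus gas plus insertion control;
  size XL, HARDEST).
* `stub_phaseClustering : DilutePhaseClustering` — at small density and large `N` the near-minimisers
  of the periodic energy cluster in `L²` of the cell modulo a phase (variational simplicity of the
  periodic ground state: Perron–Frobenius / Faris–Simon on the torus, incl. the hard-core case at low
  density; size M–L). This is the library's `hcl` hypothesis of
  `le_condensateOccupation_nearMinimiser_of_clustering` (CondensateOccupationStability.lean).
* `stub_nearMinimiserStability : DilutePhaseClustering → ReferenceBlockCoherence → BlockPhaseCoherence`
  — transport of the block-coherence inequalities from ONE reference near-minimiser per slack to ALL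
  `δ`-near-minimisers, uniformly over the block window, by the `L²`-Lipschitz continuity
  `|occ_φ(Φ) − occ_φ(Ψ)| ≤ 2N‖φ‖²‖Φ − Ψ‖` of cell occupations (size M; halves the constant).

Sorry-free: `berryStiffPhaseOS_iff` (the engine restated over named vocabulary, by `Iff.rfl`),
`blockPhaseCoherence_iff` (the target likewise), `engineSpec_of_curried` (the engine's 28 curried
hypotheses bundled into four admissibility predicates), `referenceBlockCoherence_of :
OffsetVillainRepresentation → BerryStiffPhaseOS → ReferenceBlockCoherence` (the engine is CONSUMED BY
NAME here: its constants are fed to the representation, its output to the representation's transfer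
clause), and the composition

  `PolarTransferOS_of : Sig.stub_slabDomination → Sig.stub_representation → Sig.stub_phaseClustering →
     Sig.stub_nearMinimiserStability → PolarTransferOS`
  `:= fun h₁ h₂ h₃ h₄ hLD hE => h₄ h₃ (referenceBlockCoherence_of (h₂ (h₁ hLD)) hE)`.

Conventions of `Cruxes/GDTransfer/Lines/dyson-dressed-witness.lean`: each registered obligation is
`theorem stub_<name> : Sig.stub_<name> := by sorry` with `Sig.stub_<name> : Prop` its signature.

## Disproof / negatives used

No `Cruxes/PolarTransferOS/Disproof.lean` is published and `ledger crux ls` shows no workfiles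
(2026-08-17T01:47Z); the item's evidence is the route review quoted above (honoured by
`stub_slabDomination`). The three refuted / superseded ENGINE statements of this route (14490 free
set-function large fields; 13942 time-odd complex remainder, WITNESS3.md) concern `BerryStiffPhaseOS`,
which this line only CONSUMES; the admissibility predicates below are the rev-4 class verbatim
(factorisation `IsAdmissibleLargeField.2.2.2.2.2.1`, `U(1)` invariance, OS-reality), so no stub asks for
data outside the repaired class.

## Audit (registrar, 2026-08-17, Lean farm)

`lean check --json` on this file: rc 0, `errors: []`, `sorries: 4` = exactly the four `stub_*`
declarations ("declaration uses `sorry`" at each, nowhere else); the H21 audit lists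
`PolarTransferOS_of` as proving `…Theses.BECPopovBerryRG.PolarTransferOS` modulo exactly
`Sig.stub_slabDomination`, `Sig.stub_representation`, `Sig.stub_phaseClustering`,
`Sig.stub_nearMinimiserStability`. BC3 probes (registrar folder `bc/PolarTransferOS_probe.lean`,
`bc/PolarTransferOS_probe2.lean`, attached to the item as evidence): for each of the four stubs,
`Sig.stub_X → PolarTransferOS` and `Sig.stub_X → BoseEinsteinCondensation` by
`first | exact? | simpa | aesop`, and again with `simpa [Sig.stub_X, PolarTransferOS]`,
`(unfold Sig.stub_X PolarTransferOS; simpa)`, `(unfold Sig.stub_X; exact?)`, `(unfold Sig.stub_X; aesop)`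
— 16/16 FAIL with `unsolved goals` (no stub is cheaply the crux or the summit conjunct).
-/

noncomputable section

namespace Summit.AtomisticToContinuum.BoseEinsteinCondensation.Cruxes.PolarTransferOS.Birth

open scoped BigOperators Topology Manifold Classical MeasureTheory ProbabilityTheory Matrix InnerProductSpace ComplexConjugate ContinuousMap
open Filter Set Function TopologicalSpace MeasureTheory
open Literature.MathematicalPhysics.QuantumManyBody.BoseGas
open Summit.AtomisticToContinuum.BoseEinsteinCondensation.Theses.BECPopovBerryRG

/-! ## §0 Vocabulary of the engine `BerryStiffPhaseOS` (its five `let`s as named declarations) -/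

/-- The space-time torus `(ℤ/(m+2))³ × ℤ/(n+2)` on which the engine lives. -/
abbrev Site (m n : ℕ) : Type := (Fin 3 → Fin (m + 2)) × Fin (n + 2)

/-- The engine's `near` (each coordinate within `R` on the torus, in one of the two orientations). -/
abbrev Near (R m n : ℕ) (x y : Site m n) : Prop :=
  (∀ i, ((y.1 i - x.1 i : Fin (m + 2)) : ℕ) ≤ R ∨ ((x.1 i - y.1 i : Fin (m + 2)) : ℕ) ≤ R) ∧
    (((y.2 - x.2 : Fin (n + 2)) : ℕ) ≤ R ∨ ((x.2 - y.2 : Fin (n + 2)) : ℕ) ≤ R)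

/-- The engine's `e` — the local XY energy of the four forward bonds at the site `s`. -/
abbrev locE (m n : ℕ) (s : Site m n) (θ : Site m n → ℝ) : ℝ :=
  (∑ i : Fin 3, (1 - Real.cos (θ (s.1 + Pi.single i 1, s.2) - θ s))) + (1 - Real.cos (θ (s.1, s.2 + 1) - θ s))

/-- The engine's `refl t` — time reflection about the slice `t`: `(s, τ) ↦ (s, 2t − τ)`. -/
abbrev timeRefl (m n : ℕ) (t : Fin (n + 2)) (s : Site m n) : Site m n :=
  (s.1, t + (t - s.2))

/-- The engine's weight `wt`: polymer sum over large-field sets `F` of the activity `g F`, the bond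
factors of all bonds avoiding `F`, and the remainders `e^(−Σ_(x ∉ F) w_x)`. -/
def polyWeight (m n : ℕ) (B : Fin 4 → ℝ → ℂ) (w : Site m n → (Site m n → ℝ) → ℂ)
    (g : Finset (Site m n) → (Site m n → ℝ) → ℂ) (θ : Site m n → ℝ) : ℂ :=
  ∑ F : Finset (Site m n), g F θ *
      (∏ s : (Site m n), (∏ i : Fin 3, if s ∉ F ∧ (s.1 + Pi.single i 1, s.2) ∉ F then B (Fin.castSucc i) (θ (s.1 + Pi.single i 1, s.2) - θ s) else 1) *
        (if s ∉ F ∧ (s.1, s.2 + 1) ∉ F then B (Fin.last 3) (θ (s.1, s.2 + 1) - θ s) else 1)) *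
      Complex.exp (-∑ x ∈ Fᶜ, w x θ)

/-- The engine's partition function `Z = ∫_([0,2π)^sites) wt dθ`. -/
def Zpart (m n : ℕ) (B : Fin 4 → ℝ → ℂ) (w : Site m n → (Site m n → ℝ) → ℂ)
    (g : Finset (Site m n) → (Site m n → ℝ) → ℂ) : ℂ :=
  ∫ θ in Set.pi Set.univ (fun _ : Site m n => Set.Ico (0 : ℝ) (2 * Real.pi)), polyWeight m n B w g θ

/-- `EngineCurried Λ R ε₀ K₀ C`: the BODY of `BerryStiffPhaseOS` after its three constants, verbatim
except that the five `let`s are the named declarations above — so that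
`BerryStiffPhaseOS ↔ ∀ Λ ≥ 1, ∀ R, ∃ ε₀ K₀ C > 0, EngineCurried Λ R ε₀ K₀ C` holds by `Iff.rfl`
(`berryStiffPhaseOS_iff`). -/
def EngineCurried (Λ : ℝ) (R : ℕ) (ε₀ K₀ C : ℝ) : Prop :=
  ∀ K : ℝ, K₀ ≤ K →
    ∀ m n : ℕ, ∀ Kd : Fin 4 → ℝ, (∀ i, K ≤ Kd i ∧ Kd i ≤ Λ * K) →
    ∀ δ : ℝ, |δ| ≤ 1 / 2 → (∃ z : ℤ, δ * ((m + 2 : ℕ) : ℝ) ^ 3 = (z : ℝ)) →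
    ∀ B : Fin 4 → ℝ → ℂ, (∀ i, Measurable (B i)) →
    (∀ i η, B i (η + 2 * Real.pi) = B i η) →
    (∀ i : Fin 3, ∀ η, B (Fin.castSucc i) (-η) = B (Fin.castSucc i) η ∧ (B (Fin.castSucc i) η).im = 0) →
    (∀ η, B (Fin.last 3) (-η) = (starRingEnd ℂ) (B (Fin.last 3) η)) →
    (∀ i η, |η| ≤ 1 / (4 * Λ) → ∃ u : ℂ, ‖u‖ ≤ K * η ^ 2 * (ε₀ * |η| + Λ * η ^ 2) ∧ B i η = Complex.exp (((-(Kd i * η ^ 2 / 2) : ℝ) : ℂ) + ((if i = Fin.last 3 then δ * η else 0 : ℝ) : ℂ) * Complex.I + u)) →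
    (∀ i η, |η| ≤ Real.pi → ‖B i η‖ ≤ 2 * Real.exp (-(K * (1 - Real.cos η) / 2))) →
    ∀ w : (Site m n) → ((Site m n) → ℝ) → ℂ, (∀ x, Measurable (w x)) →
    (∀ x θ y, w x (θ + Pi.single y (2 * Real.pi)) = w x θ) →
    (∀ x θ θ', (∀ y, Near R m n x y → θ y = θ' y) → w x θ = w x θ') →
    (∀ x θ, ‖w x θ‖ ≤ ε₀ * K * ∑ y, if Near R m n x y then locE m n y θ else 0) →
    (∀ x θ (a : ℝ), w x (fun s => θ s + a) = w x θ) →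
    (∀ t x θ, w (timeRefl m n t x) (fun s => θ (timeRefl m n t s)) = (starRingEnd ℂ) (w x θ)) →
    ∀ g : Finset (Site m n) → ((Site m n) → ℝ) → ℂ, (∀ F, Measurable (g F)) →
    (∀ θ, g ∅ θ = 1) →
    (∀ F θ θ', (∀ y, (∃ x ∈ F, Near R m n x y) → θ y = θ' y) → g F θ = g F θ') →
    (∀ F θ, ‖g F θ‖ ≤ Real.exp (-(K * F.card))) →
    (∀ F θ (a : ℝ), g F (fun s => θ s + a) = g F θ) →
    (∀ F₁ F₂ θ, (∀ x ∈ F₁, ∀ y ∈ F₂, ¬ Near R m n x y) → g (F₁ ∪ F₂) θ = g F₁ θ * g F₂ θ) →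
    (∀ t F θ, g (F.image (timeRefl m n t)) (fun s => θ (timeRefl m n t s)) = (starRingEnd ℂ) (g F θ)) → Zpart m n B w g ≠ 0 ∧
    ∀ x y : (Site m n), x.2 = y.2 →
    ∀ O P : ((Site m n) → ℝ) → ℂ, Measurable O → Measurable P →
    (∀ θ θ', (∀ s, Near R m n x s → θ s = θ' s) → O θ = O θ') →
    (∀ θ θ', (∀ s, Near R m n y s → θ s = θ' s) → P θ = P θ') →
    (∀ θ, ‖O θ - 1‖ ≤ ∑ s, if Near R m n x s then Real.sqrt (locE m n s θ) else 0) →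
    (∀ θ, ‖P θ - 1‖ ≤ ∑ s, if Near R m n y s then Real.sqrt (locE m n s θ) else 0) →
    (∀ θ (a : ℝ), O (fun s => θ s + a) = O θ) →
    (∀ θ (a : ℝ), P (fun s => θ s + a) = P θ) →
    (∀ θ, O (fun s => θ (timeRefl m n x.2 s)) = (starRingEnd ℂ) (O θ)) →
    (∀ θ, P (fun s => θ (timeRefl m n x.2 s)) = (starRingEnd ℂ) (P θ)) → ‖(∫ θ in Set.pi Set.univ (fun _ : (Site m n) => Set.Ico (0 : ℝ) (2 * Real.pi)), (Real.cos (θ x - θ y) : ℂ) * O θ * P θ * polyWeight m n B w g θ) - Zpart m n B w g‖ ≤ C / Real.sqrt K * ‖Zpart m n B w g‖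

/-- The engine is, DEFINITIONALLY, `∀ Λ ≥ 1, ∀ R, ∃ ε₀ K₀ C > 0, EngineCurried Λ R ε₀ K₀ C`. -/
theorem berryStiffPhaseOS_iff :
    BerryStiffPhaseOS ↔
      ∀ Λ : ℝ, 1 ≤ Λ → ∀ R : ℕ, ∃ ε₀ K₀ C : ℝ, 0 < ε₀ ∧ 0 < K₀ ∧ 0 < C ∧ EngineCurried Λ R ε₀ K₀ C :=
  Iff.rfl

/-! ## §1 The engine's hypotheses bundled into admissibility predicates, and its output -/

/-- ADMISSIBLE BOND DATA of the OS-real stiff-phase class at `(Λ, ε₀, K)` on spatial extent `m + 2`: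
stiffnesses `K ≤ K_i ≤ ΛK`, Berry offset `|δ| ≤ 1/2` with `δ(m+2)³ ∈ ℤ`, bond factors measurable,
`2π`-periodic, spatial ones real and even, the temporal one Hermitian (`B(−η) = conj B(η)`), Gaussian
core `exp(−K_iη²/2 + iδη·[temporal] + u)` with `|u| ≤ Kη²(ε₀|η| + Λη²)` on `|η| ≤ 1/(4Λ)`, and the
Peierls floor `‖B_i(η)‖ ≤ 2e^{−K(1 − cos η)/2}` (hypotheses 1–3 and 4–9 of the engine, verbatim). -/
def IsAdmissibleBond (Λ ε₀ K : ℝ) (m : ℕ) (Kd : Fin 4 → ℝ) (δ : ℝ) (B : Fin 4 → ℝ → ℂ) : Prop :=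
  (∀ i, K ≤ Kd i ∧ Kd i ≤ Λ * K) ∧ |δ| ≤ 1 / 2 ∧ (∃ z : ℤ, δ * ((m + 2 : ℕ) : ℝ) ^ 3 = (z : ℝ)) ∧
  (∀ i, Measurable (B i)) ∧ (∀ i η, B i (η + 2 * Real.pi) = B i η) ∧
  (∀ i : Fin 3, ∀ η, B (Fin.castSucc i) (-η) = B (Fin.castSucc i) η ∧ (B (Fin.castSucc i) η).im = 0) ∧
  (∀ η, B (Fin.last 3) (-η) = (starRingEnd ℂ) (B (Fin.last 3) η)) ∧
  (∀ i η, |η| ≤ 1 / (4 * Λ) → ∃ u : ℂ, ‖u‖ ≤ K * η ^ 2 * (ε₀ * |η| + Λ * η ^ 2) ∧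
    B i η = Complex.exp (((-(Kd i * η ^ 2 / 2) : ℝ) : ℂ) +
      ((if i = Fin.last 3 then δ * η else 0 : ℝ) : ℂ) * Complex.I + u)) ∧
  (∀ i η, |η| ≤ Real.pi → ‖B i η‖ ≤ 2 * Real.exp (-(K * (1 - Real.cos η) / 2)))

/-- ADMISSIBLE REMAINDER `w` (complex, range `R`, measurable, `2π`-periodic in every angle, dominated
by `ε₀K·(local XY energy near x)`, invariant under the global shift `θ ↦ θ + a`, and OS-real:
`w_{R_t x}(θ ∘ R_t) = conj w_x(θ)` for every time reflection) — hypotheses 10–15 of the engine. -/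
def IsAdmissibleRemainder (R : ℕ) (ε₀ K : ℝ) (m n : ℕ) (w : Site m n → (Site m n → ℝ) → ℂ) : Prop :=
  (∀ x, Measurable (w x)) ∧ (∀ x θ y, w x (θ + Pi.single y (2 * Real.pi)) = w x θ) ∧
  (∀ x θ θ', (∀ y, Near R m n x y → θ y = θ' y) → w x θ = w x θ') ∧
  (∀ x θ, ‖w x θ‖ ≤ ε₀ * K * ∑ y, if Near R m n x y then locE m n y θ else 0) ∧
  (∀ x θ (a : ℝ), w x (fun s => θ s + a) = w x θ) ∧
  (∀ t x θ, w (timeRefl m n t x) (fun s => θ (timeRefl m n t s)) = (starRingEnd ℂ) (w x θ))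

/-- ADMISSIBLE LARGE-FIELD ACTIVITIES `g_F` (measurable, `g_∅ = 1`, local near `F`,
`‖g_F‖ ≤ e^{−K|F|}`, `U(1)`-invariant, MULTIPLICATIVE over `R`-separated unions, OS-real) — hypotheses
16–22 of the engine; the factorisation and OS-reality clauses are the rev-2 / rev-4 repairs. -/
def IsAdmissibleLargeField (R : ℕ) (K : ℝ) (m n : ℕ)
    (g : Finset (Site m n) → (Site m n → ℝ) → ℂ) : Prop :=
  (∀ F, Measurable (g F)) ∧ (∀ θ, g ∅ θ = 1) ∧
  (∀ F θ θ', (∀ y, (∃ x ∈ F, Near R m n x y) → θ y = θ' y) → g F θ = g F θ') ∧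
  (∀ F θ, ‖g F θ‖ ≤ Real.exp (-(K * F.card))) ∧
  (∀ F θ (a : ℝ), g F (fun s => θ s + a) = g F θ) ∧
  (∀ F₁ F₂ θ, (∀ x ∈ F₁, ∀ y ∈ F₂, ¬ Near R m n x y) → g (F₁ ∪ F₂) θ = g F₁ θ * g F₂ θ) ∧
  (∀ t F θ, g (F.image (timeRefl m n t)) (fun s => θ (timeRefl m n t s)) = (starRingEnd ℂ) (g F θ))

/-- ADMISSIBLE INSERTION `O` at the site `x`, OS-real through the slice `t` (measurable, local near `x`,
`|O − 1| ≤ Σ_(s near x) √e_s`, shift-invariant, `O(θ ∘ R_t) = conj O(θ)`) — the engine's five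
hypotheses on each of `O`, `P` (with `t = x.2 = y.2`). -/
def IsAdmissibleInsertion (R m n : ℕ) (t : Fin (n + 2)) (x : Site m n) (O : (Site m n → ℝ) → ℂ) :
    Prop :=
  Measurable O ∧ (∀ θ θ', (∀ s, Near R m n x s → θ s = θ' s) → O θ = O θ') ∧
  (∀ θ, ‖O θ - 1‖ ≤ ∑ s, if Near R m n x s then Real.sqrt (locE m n s θ) else 0) ∧
  (∀ θ (a : ℝ), O (fun s => θ s + a) = O θ) ∧
  (∀ θ, O (fun s => θ (timeRefl m n t s)) = (starRingEnd ℂ) (O θ))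

/-- The inserted two-point integral `∫ cos(θ_x − θ_y)·O·P·wt dθ` of the engine's conclusion. -/
def corrInt (m n : ℕ) (B : Fin 4 → ℝ → ℂ) (w : Site m n → (Site m n → ℝ) → ℂ)
    (g : Finset (Site m n) → (Site m n → ℝ) → ℂ) (x y : Site m n) (O P : (Site m n → ℝ) → ℂ) : ℂ :=
  ∫ θ in Set.pi Set.univ (fun _ : Site m n => Set.Ico (0 : ℝ) (2 * Real.pi)),
    (Real.cos (θ x - θ y) : ℂ) * O θ * P θ * polyWeight m n B w g θ

/-- THE ENGINE'S OUTPUT for one pair of insertions: `‖∫cos·O·P·wt − Z‖ ≤ (C/√K)‖Z‖`. -/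
def EngineBound (C K : ℝ) (m n : ℕ) (B : Fin 4 → ℝ → ℂ) (w : Site m n → (Site m n → ℝ) → ℂ)
    (g : Finset (Site m n) → (Site m n → ℝ) → ℂ) (x y : Site m n) (O P : (Site m n → ℝ) → ℂ) : Prop :=
  ‖corrInt m n B w g x y O P - Zpart m n B w g‖ ≤ C / Real.sqrt K * ‖Zpart m n B w g‖

/-- The engine at constants `(Λ, R, ε₀, K₀, C)`, with its 28 curried hypotheses BUNDLED:
admissible bonds, remainder and large fields give `Z ≠ 0` and the bound `EngineBound` for every pair of
admissible equal-time insertions (`engineSpec_of_curried`). -/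
def EngineSpec (Λ : ℝ) (R : ℕ) (ε₀ K₀ C : ℝ) : Prop :=
  ∀ K : ℝ, K₀ ≤ K → ∀ (m n : ℕ) (Kd : Fin 4 → ℝ) (δ : ℝ) (B : Fin 4 → ℝ → ℂ),
    IsAdmissibleBond Λ ε₀ K m Kd δ B →
    ∀ w : Site m n → (Site m n → ℝ) → ℂ, IsAdmissibleRemainder R ε₀ K m n w →
    ∀ g : Finset (Site m n) → (Site m n → ℝ) → ℂ, IsAdmissibleLargeField R K m n g →
      Zpart m n B w g ≠ 0 ∧ ∀ x y : Site m n, x.2 = y.2 → ∀ O P : (Site m n → ℝ) → ℂ,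
        IsAdmissibleInsertion R m n x.2 x O → IsAdmissibleInsertion R m n x.2 y P →
          EngineBound C K m n B w g x y O P

/-- Bundling: the curried engine body implies the bundled one (pure re-threading of hypotheses). -/
theorem engineSpec_of_curried {Λ : ℝ} {R : ℕ} {ε₀ K₀ C : ℝ} (h : EngineCurried Λ R ε₀ K₀ C) :
    EngineSpec Λ R ε₀ K₀ C := by
  intro K hK m n Kd δ B hB w hw g hg
  obtain ⟨hKd, hδ, hint, hB1, hB2, hB3, hB4, hB5, hB6⟩ := hB
  obtain ⟨hw1, hw2, hw3, hw4, hw5, hw6⟩ := hw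
  obtain ⟨hg1, hg2, hg3, hg4, hg5, hg6, hg7⟩ := hg
  obtain ⟨hZ, hc⟩ := h K hK m n Kd hKd δ hδ hint B hB1 hB2 hB3 hB4 hB5 hB6 w hw1 hw2 hw3 hw4 hw5 hw6
    g hg1 hg2 hg3 hg4 hg5 hg6 hg7
  refine ⟨hZ, fun x y hxy O P hO hP => ?_⟩
  obtain ⟨hO1, hO2, hO3, hO4, hO5⟩ := hO
  obtain ⟨hP1, hP2, hP3, hP4, hP5⟩ := hP
  exact hc x y hxy O P hO1 hP1 hO2 hP2 hO3 hP3 hO4 hP4 hO5 hP5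

/-- The route's engine, BY NAME, delivers the bundled engine at every `Λ ≥ 1`, `R`. -/
theorem engineSpec_of_berryStiffPhaseOS (hE : BerryStiffPhaseOS) {Λ : ℝ} (hΛ : 1 ≤ Λ) (R : ℕ) :
    ∃ ε₀ K₀ C : ℝ, 0 < ε₀ ∧ 0 < K₀ ∧ 0 < C ∧ EngineSpec Λ R ε₀ K₀ C := by
  obtain ⟨ε₀, K₀, C, h₁, h₂, h₃, h⟩ := berryStiffPhaseOS_iff.mp hE Λ hΛ R
  exact ⟨ε₀, K₀, C, h₁, h₂, h₃, engineSpec_of_curried h⟩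

/-! ## §2 Bose-gas side: blocks, pair coherence, and the four intermediate statements -/

/-- The block `z` of side `ℓ` (block number `mb` per axis): `Π_k [z_k ℓ, (z_k + 1)ℓ)` — verbatim the set
whose indicator the route's `BlockPhaseCoherence` / `BlockOccupationLD` use. -/
def blockSet (ℓ : ℝ) (mb : ℕ) (z : Fin 3 → Fin mb) : Set Space :=
  {x : EuclideanSpace ℝ (Fin 3) | ∀ k, x k ∈ Set.Ico (((z k : ℕ) : ℝ) * ℓ) ((((z k : ℕ) : ℝ) + 1) * ℓ)}

/-- The normalised block mode `φ_z = ℓ^{-3/2} 1_(block z)` (the route's `let φ`). -/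
def blockMode (ℓ : ℝ) (mb : ℕ) (z : Fin 3 → Fin mb) : Space → ℂ :=
  (blockSet ℓ mb z).indicator (fun _ => ((Real.sqrt (ℓ ^ 3))⁻¹ : ℂ))

/-- PAIR COHERENCE of the blocks `z, z'` in the `N`-body function `Ψ` on the cell of side `L`, in the
route's polarisation form: `occ(φ_z + φ_z') ≥ occ(φ_z) + occ(φ_z') + 2cρℓ³`
(i.e. `Re⟨φ_z, γ_Ψ φ_z'⟩ ≥ cρℓ³`). -/
def PairCoherent (c ρ : ℝ) (N : ℕ) (L ℓ : ℝ) (mb : ℕ) (z z' : Fin 3 → Fin mb) (Ψ : Config N → ℂ) :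
    Prop :=
  cellOccupation N L (blockMode ℓ mb z) Ψ + cellOccupation N L (blockMode ℓ mb z') Ψ +
      ENNReal.ofReal (2 * c * ρ * ℓ ^ 3) ≤
    cellOccupation N L (fun x => blockMode ℓ mb z x + blockMode ℓ mb z' x) Ψ

/-- The route's TARGET restated over `PairCoherent` — DEFINITIONALLY (`Iff.rfl`; the route's three
`let`s zeta-reduce). The prover of `stub_nearMinimiserStability` concludes through this. -/
theorem blockPhaseCoherence_iff :
    BlockPhaseCoherence ↔
      ∀ v : ℝ → ENNReal, IsRepulsiveFiniteRange v → ∃ ρ₀ : ℝ, 0 < ρ₀ ∧ ∀ ρ : ℝ, 0 < ρ → ρ < ρ₀ →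
        ∃ c ℓ₀ ℓ₁ : ℝ, 0 < c ∧ 0 < ℓ₀ ∧ 2 * ℓ₀ ≤ ℓ₁ ∧ ∀ᶠ N : ℕ in Filter.atTop, ∃ δ : ENNReal, 0 < δ ∧
          ∀ Ψ : PeriodicTrialState N (sideLength ρ N),
            periodicEnergy v Ψ ≤ periodicGroundStateEnergy v N (sideLength ρ N) + δ →
            ∀ mb : ℕ, 0 < mb → ℓ₀ ≤ sideLength ρ N / mb → sideLength ρ N / mb ≤ ℓ₁ →
              ∀ z z' : Fin 3 → Fin mb,
                PairCoherent c ρ N (sideLength ρ N) (sideLength ρ N / mb) mb z z' Ψ.ψ :=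
  Iff.rfl

/-- **MultiSlabLD — joint (multi-block) occupation large deviations.** For every repulsive
finite-range `v` there is `ρ₀ > 0` such that for `0 < ρ < ρ₀` and every deficit fraction `η ∈ (0,1)`
there are `c, ℓ₀ > 0` with: for all large `N` there is `δ > 0` such that for every `δ`-near-minimiser
`Ψ` of the periodic energy on the torus of side `L = (N/ρ)^{1/3}`, every block number `mb` with
`ℓ = L/mb ≥ ℓ₀` and every FAMILY `F` of blocks, the `|Ψ|²`-probability (on the fundamental cell) that
EVERY block of `F` holds at most `(1 − η)ρℓ³` particles is `≤ exp(−cρℓ³·|F|)`. (`F = {z}` is the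
route's `BlockOccupationLD` = stmt-14491; at `v = 0` the exact ground state is constant and the bound is
the multinomial Chernoff bound with any `c < h(η) = η + (1−η)log(1−η)`, uniformly in `|F|`, since
`KL((1−η)q ‖ q) ≥ q·h(η)`; `F = ∅` is `1 ≤ 1`.) This is the large-field input of the engine for UNIONS
of deficient block-slabs: activity `≤ e^{−cρℓ³|F|} ≤ e^{−K|F|}` because `ρℓ³/K ≍ ℓ/ξ → ∞`. -/
def MultiSlabLD : Prop :=
  ∀ v : ℝ → ENNReal, IsRepulsiveFiniteRange v → ∃ ρ₀ : ℝ, 0 < ρ₀ ∧ ∀ ρ : ℝ, 0 < ρ → ρ < ρ₀ →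
    ∀ η : ℝ, 0 < η → η < 1 → ∃ c ℓ₀ : ℝ, 0 < c ∧ 0 < ℓ₀ ∧ ∀ᶠ N : ℕ in Filter.atTop,
      ∃ δ : ENNReal, 0 < δ ∧ ∀ Ψ : PeriodicTrialState N (sideLength ρ N),
        periodicEnergy v Ψ ≤ periodicGroundStateEnergy v N (sideLength ρ N) + δ →
        ∀ mb : ℕ, 0 < mb → ℓ₀ ≤ sideLength ρ N / mb → ∀ F : Finset (Fin 3 → Fin mb),
          ∫⁻ X in {X : Config N | X ∈ cellN N (sideLength ρ N) ∧ ∀ z ∈ F,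
              (∑ i, (blockSet (sideLength ρ N / mb) mb z).indicator (fun _ => (1 : ℝ)) (X i)) ≤
                (1 - η) * ρ * (sideLength ρ N / mb) ^ 3},
            (‖Ψ.ψ X‖₊ : ENNReal) ^ 2 ≤
          ENNReal.ofReal (Real.exp (-(c * ρ * (sideLength ρ N / mb) ^ 3 * F.card)))

/-- **ReferenceBlockCoherence — block coherence of ONE reference near-minimiser per slack.** For every
repulsive finite-range `v` there is `ρ₀ > 0` such that for `0 < ρ < ρ₀` there are `c > 0` and a block
window `0 < ℓ₀`, `2ℓ₀ ≤ ℓ₁` with: for all large `N` and EVERY slack `δ > 0` there EXISTS a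
`δ`-near-minimiser `Ψ` (intended: a truncation of the ground state / the `β → ∞` limit of the thermal
state delivered by the representation) all of whose block pairs in the window are `c`-coherent.
Weaker than the target (`∃ Ψ` per slack instead of `∀ Ψ`); the output of the engine feed
`referenceBlockCoherence_of`, the input of `stub_nearMinimiserStability`. -/
def ReferenceBlockCoherence : Prop :=
  ∀ v : ℝ → ENNReal, IsRepulsiveFiniteRange v → ∃ ρ₀ : ℝ, 0 < ρ₀ ∧ ∀ ρ : ℝ, 0 < ρ → ρ < ρ₀ →
    ∃ c ℓ₀ ℓ₁ : ℝ, 0 < c ∧ 0 < ℓ₀ ∧ 2 * ℓ₀ ≤ ℓ₁ ∧ ∀ᶠ N : ℕ in Filter.atTop, ∀ δ : ENNReal, 0 < δ →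
      ∃ Ψ : PeriodicTrialState N (sideLength ρ N),
        periodicEnergy v Ψ ≤ periodicGroundStateEnergy v N (sideLength ρ N) + δ ∧
        ∀ mb : ℕ, 0 < mb → ℓ₀ ≤ sideLength ρ N / mb → sideLength ρ N / mb ≤ ℓ₁ →
          ∀ z z' : Fin 3 → Fin mb, PairCoherent c ρ N (sideLength ρ N) (sideLength ρ N / mb) mb z z' Ψ.ψ

/-- **DilutePhaseClustering — variational simplicity of the periodic ground state in the dilute
regime.** For every repulsive finite-range `v` there is `ρ₀ > 0` such that for `0 < ρ < ρ₀` and all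
large `N` (`L = (N/ρ)^{1/3}`): for every `η > 0` there is `δ > 0` such that any two `δ`-near-minimisers
`Φ, Φ'` of the periodic energy satisfy `∫_{cell^N} |Φ − e^{iθ}Φ'|² ≤ η` for some phase `θ` — verbatim
the clustering hypothesis `hcl` of
`Literature.MathematicalPhysics.QuantumManyBody.BoseGas.le_condensateOccupation_nearMinimiser_of_clustering`.
(Mechanism: `E₀^per < ∞` by Dyson's bound once `2R₀ < L` and `ρ` is small; the form has compact
resolvent; the bosonic ground state is SIMPLE — `PeriodicGroundStateNondegenerate[Integrable]` for
bounded / integrable `v`, Perron–Frobenius on the connected low-density hard-sphere configuration space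
of the torus for hard cores — so `‖Φ − P₀Φ‖² ≤ (E(Φ) − E₀)/(E₁ − E₀)`.) -/
def DilutePhaseClustering : Prop :=
  ∀ v : ℝ → ENNReal, IsRepulsiveFiniteRange v → ∃ ρ₀ : ℝ, 0 < ρ₀ ∧ ∀ ρ : ℝ, 0 < ρ → ρ < ρ₀ →
    ∀ᶠ N : ℕ in Filter.atTop, ∀ η : ℝ, 0 < η → ∃ δ : ENNReal, 0 < δ ∧
      ∀ Φ Φ' : PeriodicTrialState N (sideLength ρ N),
        periodicEnergy v Φ ≤ periodicGroundStateEnergy v N (sideLength ρ N) + δ →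
        periodicEnergy v Φ' ≤ periodicGroundStateEnergy v N (sideLength ρ N) + δ →
          ∃ θ : ℝ, ∫ X in cellN N (sideLength ρ N),
            ‖Φ.ψ X - Complex.exp (θ * Complex.I) * Φ'.ψ X‖ ^ 2 ≤ η

/-- **OffsetVillainRepresentation — THE BET, typed.** There are a class anisotropy `Λ ≥ 1` and a range
`R` (properties of the blocked model) such that for EVERY triple `(ε₀, K₀, C)` of positive constants
(those the engine returns at `(Λ, R)`): for every repulsive finite-range `v` there is `ρ₀ > 0`, and for
`0 < ρ < ρ₀` constants `c > 0`, `0 < ℓ₀`, `2ℓ₀ ≤ ℓ₁` (the Fournais window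
`ℓ ≍ (ρa³)^{−δ'}(ρa)^{−1/2}`, where `K ≍ (ℓ/ξ)²(ρa³)^{−1/2} ≥ max(K₀, 4C²)` and `ξ/ℓ ≤ ε₀`), such
that for all large `N` and every slack `δ > 0` there is a `δ`-near-minimiser `Ψ` (the reference state)
with: for every block number `mb` in the window and every pair of blocks `(z, z')` there exist a
stiffness `K ≥ K₀`, a space-time torus `(ℤ/(m+2))³ × ℤ/(n+2)`, and ADMISSIBLE class data
(`IsAdmissibleBond Λ ε₀ K`, `IsAdmissibleRemainder R ε₀ K`, `IsAdmissibleLargeField R K`, two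
`IsAdmissibleInsertion`s at equal-time sites `x, y`) — intended: the exact number–phase / offset-Villain
transcription of the blocked torus gas (block numbers summed at a tuned block chemical potential,
offset-Villain temporal bond, near-cosine spatial bonds, imaginary Galilean cubic + wrong-sign quartic as
`w` with `ε₀ ≍ ξ/ℓ`, deficient block-slabs as large fields with activities controlled by `MultiSlabLD`,
`√n` factors as the insertions `O, P`) — FOR WHICH the engine's output (`Z ≠ 0` and
`‖∫cos(θ_x − θ_y)·O·P·wt − Z‖ ≤ (C/√K)‖Z‖`) IMPLIES the pair coherence
`occ(φ_z + φ_z') ≥ occ(φ_z) + occ(φ_z') + 2cρℓ³` of `Ψ` (insertion control: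
`Re⟨a*(φ_z)a(φ_z')⟩ = n̄·Re⟨cos·O·P⟩ + O(√(ρa³))ρℓ³ ≥ ρℓ³(1 − O(√(ρa³)) − C/√K) ≥ cρℓ³`).
A witness with data unrelated to `Ψ` gains nothing: for admissible data the premise is the engine's
theorem, so the clause is then the coherence inequality itself. -/
def OffsetVillainRepresentation : Prop :=
  ∃ Λ : ℝ, 1 ≤ Λ ∧ ∃ R : ℕ, ∀ ε₀ K₀ C : ℝ, 0 < ε₀ → 0 < K₀ → 0 < C →
    ∀ v : ℝ → ENNReal, IsRepulsiveFiniteRange v → ∃ ρ₀ : ℝ, 0 < ρ₀ ∧ ∀ ρ : ℝ, 0 < ρ → ρ < ρ₀ →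
      ∃ c ℓ₀ ℓ₁ : ℝ, 0 < c ∧ 0 < ℓ₀ ∧ 2 * ℓ₀ ≤ ℓ₁ ∧ ∀ᶠ N : ℕ in Filter.atTop, ∀ δ : ENNReal, 0 < δ →
        ∃ Ψ : PeriodicTrialState N (sideLength ρ N),
          periodicEnergy v Ψ ≤ periodicGroundStateEnergy v N (sideLength ρ N) + δ ∧
          ∀ mb : ℕ, 0 < mb → ℓ₀ ≤ sideLength ρ N / mb → sideLength ρ N / mb ≤ ℓ₁ →
            ∀ z z' : Fin 3 → Fin mb,
              ∃ K : ℝ, K₀ ≤ K ∧ ∃ m n : ℕ, ∃ Kd : Fin 4 → ℝ, ∃ δB : ℝ, ∃ B : Fin 4 → ℝ → ℂ,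
                ∃ w : Site m n → (Site m n → ℝ) → ℂ, ∃ g : Finset (Site m n) → (Site m n → ℝ) → ℂ,
                ∃ x y : Site m n, ∃ O P : (Site m n → ℝ) → ℂ,
                  IsAdmissibleBond Λ ε₀ K m Kd δB B ∧ IsAdmissibleRemainder R ε₀ K m n w ∧
                  IsAdmissibleLargeField R K m n g ∧ x.2 = y.2 ∧
                  IsAdmissibleInsertion R m n x.2 x O ∧ IsAdmissibleInsertion R m n x.2 y P ∧
                  (Zpart m n B w g ≠ 0 → EngineBound C K m n B w g x y O P →
                    PairCoherent c ρ N (sideLength ρ N) (sideLength ρ N / mb) mb z z' Ψ.ψ)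

/-! ## §3 Stub signatures (`Sig.stub_<name>` is the registered signature of `stub_<name>`) -/

/-- **Signature of `stub_slabDomination` — MULTI-SLAB DOMINATION (size L; probability / variational).**
`BlockOccupationLD → MultiSlabLD`: the route's single-block volume-order lower tail upgraded to the
joint tail with rate additive in the number of blocks. Why plausibly true: at `v = 0` it is the
multinomial Chernoff bound; for the interacting gas a deficient family forces a density surplus of
`η|F|ρℓ³` particles elsewhere whose compression energy is extensive in `|F|ρℓ³`, and the `|Ψ|²`-mass of
such configurations in a near-minimiser (slack `δ` chosen AFTER `N`) is governed by the same
localisation mechanism as the single block. Why it might fail: deficits of different blocks are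
correlated through the fixed total `N` and the phonon field (`Var N_B ∝ ℓ² log ℓ`), and the marginal
tails of 14491 do not imply joint tails — the stub may need to re-run the (unproved) LD mechanism for
families rather than use 14491 as a black box (route review REVIEW-BEC.md). Leans on: `BlockOccupationLD`
(stmt-14491), `Fournais2020_condensation` (in tree), LHY-precision block energies.
[AstrakharchikCombescotPitaevskii2007; LiebSeiringerSolovejYngvason2005 Ch. 2; FournaisSolovej2020] -/
def Sig.stub_slabDomination : Prop :=
  BlockOccupationLD → MultiSlabLD

/-- **Signature of `stub_representation` — THE OFFSET-VILLAIN REPRESENTATION + INSERTION CONTROL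
(size XL; HARDEST, load-bearing).** `MultiSlabLD → OffsetVillainRepresentation`. The constructive
step of the route: Fournais-window blocks, slabs `τ₀ = ℓ/c_s`, the thermal state at `β = (n+2)τ₀`
written by time-slicing `Tr e^{−βH}` in block number–phase variables with integer block numbers summed
exactly at a tuned block chemical potential (`δ(m+2)³ ∈ ℤ`), giving the offset-Villain temporal bond,
real even near-cosine spatial bonds, the imaginary Galilean cubic + wrong-sign quartic as the
`ε₀ ≍ ξ/ℓ`-dominated OS-real remainder, deficient block-slabs as factorising large fields (activities from
`MultiSlabLD`), `√n` factors as OS-real symmetrised insertions; then `β → ∞` along the fixed-`(N,L)`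
gap to a reference near-minimiser. Why it might fail (the item's own list): the delivered remainder is
exponentially, not finitely, ranged (intra-block gap `≍ c_s/ℓ`) — the engine would then have to be
widened by a `--resplit` (`R ↦` decay rate), never the remainder truncated; grand-canonical block sums
versus `N`-body states; one-mode reduction of `a*(φ_z)` needs correlation control; OS-symmetric
indexing must survive the cumulant re-exponentiation; and the space-time (unequal-time) joint
large-field bound must be derived from the equal-time `MultiSlabLD`. Leans on: `BerryStiffPhaseOS`'s
class exactly as bundled in §1; `Fournais2020_condensation`; `PeriodicFeynmanKac*` (in tree) for the
time-slicing. [arXiv:1609.00968; BalabanEtAl2010; Benfatto1994; PistolesiEtAl2004; DupuisRancon2011;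
Sachdev2011 Ch. 9; FisherEtAl1989] -/
def Sig.stub_representation : Prop :=
  MultiSlabLD → OffsetVillainRepresentation

/-- **Signature of `stub_phaseClustering` — VARIATIONAL SIMPLICITY IN THE DILUTE REGIME (size M–L;
spectral theory).** `DilutePhaseClustering`. Why plausibly true: compact resolvent of the periodic form
at fixed `(N, L)`, finiteness of `E₀^per` at low density (Dyson's trial state, `LSSY2005_upperBound_periodic`
in tree), and simplicity of the bosonic ground state (in tree as named facts
`PeriodicGroundStateNondegenerate` / `…Integrable` for bounded / integrable `v`). Why it might fail: for
HARD-CORE `v` (allowed by `IsRepulsiveFiniteRange`) simplicity needs connectedness of the hard-sphere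
configuration space of the torus, true at low density but not in print as a theorem; at `ρ ≥ ρ₀` or
small `N` the statement is false (`E₀ = ⊤` or disconnected), hence the dilute / eventual quantifiers.
[ReedSimonIV1978 §XIII.12; FarisSimon1975; LiebSeiringerSolovejYngvason2005 Thm 2.2] -/
def Sig.stub_phaseClustering : Prop :=
  DilutePhaseClustering

/-- **Signature of `stub_nearMinimiserStability` — FROM ONE NEAR-MINIMISER TO ALL (size M; functional
analysis on the cell).** `DilutePhaseClustering → ReferenceBlockCoherence → BlockPhaseCoherence`.
Proof plan: for large `N` put `η_N = (cρℓ₀³/(8N))²`, take `δ` from clustering at `η_N` (and below the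
reference slack); for a `δ`-near-minimiser `Φ` and the reference `Ψ` at slack `δ`, clustering gives
`‖Φ − e^{iθ}Ψ‖² ≤ η_N`; cell occupations are phase invariant and `L²`-Lipschitz on the unit ball,
`|occ_φ(Φ) − occ_φ(Ψ)| ≤ 2N‖φ‖₂²‖Φ − Ψ‖₂` (`a(φ)` is bounded by `√N‖φ‖`; in tree for the constant mode:
`abs_toReal_condensateOccupation_sub_le`), so the polarisation combination moves by at most
`(4 + 2 + 2)N√η_N = cρℓ₀³ ≤ cρℓ³`, and `4cρℓ³ − cρℓ³ ≥ 2cρℓ³`: `BlockPhaseCoherence` with `c/2`…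
precisely, reference constant `c` gives target constant `c/2` (conclude through
`blockPhaseCoherence_iff`). Why it might fail: only `ℝ≥0∞` bookkeeping (occupations of bounded modes
against normalised `C¹` states are finite). [LiebSeiringerSolovejYngvason2005 §1.2 (1.17), App. A;
Fournais2020 (1.3)–(1.5)] -/
def Sig.stub_nearMinimiserStability : Prop :=
  DilutePhaseClustering → ReferenceBlockCoherence → BlockPhaseCoherence

/-! ## §4 The registered stubs (`sorry` lives only in these four theorems) -/

/-- Registered stub 1 — multi-slab domination (joint occupation large deviations). -/
theorem stub_slabDomination : Sig.stub_slabDomination := by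
  sorry

/-- Registered stub 2 — the offset-Villain representation with insertion control (HARDEST). -/
theorem stub_representation : Sig.stub_representation := by
  sorry

/-- Registered stub 3 — clustering of near-minimisers modulo a phase in the dilute regime. -/
theorem stub_phaseClustering : Sig.stub_phaseClustering := by
  sorry

/-- Registered stub 4 — stability: one coherent near-minimiser per slack ⇒ all near-minimisers. -/
theorem stub_nearMinimiserStability : Sig.stub_nearMinimiserStability := by
  sorry

/-! ## §5 Sorry-free glue: the engine is consumed BY NAME, and the composition concludes the crux -/

/-- **Engine feed.** The representation's `(Λ, R)` are handed to the route's engine `BerryStiffPhaseOS`,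
the engine's constants `(ε₀, K₀, C)` back to the representation, and for the admissible data the
representation supplies the engine's output discharges the transfer clause: block coherence of the
reference near-minimiser. -/
theorem referenceBlockCoherence_of (hR : OffsetVillainRepresentation) (hE : BerryStiffPhaseOS) :
    ReferenceBlockCoherence := by
  obtain ⟨Λ, hΛ, R, hR⟩ := hR
  obtain ⟨ε₀, K₀, C, hε₀, hK₀, hC, hS⟩ := engineSpec_of_berryStiffPhaseOS hE hΛ R
  intro v hv
  obtain ⟨ρ₀, hρ₀, hρ⟩ := hR ε₀ K₀ C hε₀ hK₀ hC v hv
  refine ⟨ρ₀, hρ₀, fun ρ hρpos hρlt => ?_⟩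
  obtain ⟨c, ℓ₀, ℓ₁, hc, hℓ₀, hℓ₁, hN⟩ := hρ ρ hρpos hρlt
  refine ⟨c, ℓ₀, ℓ₁, hc, hℓ₀, hℓ₁, hN.mono fun N hN' => ?_⟩
  intro δ hδ
  obtain ⟨Ψ, hΨ, hb⟩ := hN' δ hδ
  refine ⟨Ψ, hΨ, ?_⟩
  intro mb hmb hlo hhi z z'
  obtain ⟨K, hK, m, n, Kd, δB, B, w, g, x, y, O, P, hB, hw, hg, hxy, hO, hP, himp⟩ :=
    hb mb hmb hlo hhi z z'
  obtain ⟨hZ, hcorr⟩ := hS K hK m n Kd δB B hB w hw g hg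
  exact himp hZ (hcorr x y hxy O P hO hP)

/-- **The line concludes the crux BY NAME.** `BlockOccupationLD` ⟶ (stub 1) joint large deviations ⟶
(stub 2) the offset-Villain representation ⟶ (engine feed, sorry-free, consuming `BerryStiffPhaseOS`)
block coherence of a reference near-minimiser ⟶ (stub 4, fed with the clustering of stub 3) the target
`BlockPhaseCoherence` for all near-minimisers. -/
theorem PolarTransferOS_of :
    Sig.stub_slabDomination → Sig.stub_representation → Sig.stub_phaseClustering →
      Sig.stub_nearMinimiserStability →
        Summit.AtomisticToContinuum.BoseEinsteinCondensation.Theses.BECPopovBerryRG.PolarTransferOS := by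
  intro h₁ h₂ h₃ h₄ hLD hE
  exact h₄ h₃ (referenceBlockCoherence_of (h₂ (h₁ hLD)) hE)

/-- Wiring check: the crux modulo the four registered stubs (an `example`, so that `PolarTransferOS_of`
is the only theorem of the file concluding the crux). -/
example : PolarTransferOS :=
  PolarTransferOS_of stub_slabDomination stub_representation stub_phaseClustering
    stub_nearMinimiserStability

/-! ## §6 Sanity pins (sorry-free) -/

/-- The crux is an implication between three route predicates, DEFINITIONALLY. -/
example : PolarTransferOS ↔ (BlockOccupationLD → BerryStiffPhaseOS → BlockPhaseCoherence) := Iff.rfl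

/-- The in-tree transfer lemma whose clustering hypothesis `DilutePhaseClustering` supplies eventually in
`N` (used in kind by `stub_nearMinimiserStability`). -/
example {N : ℕ} {L : ℝ} (hL : 0 < L) (v : ℝ → ENNReal)
    (hcl : ∀ η : ℝ, 0 < η → ∃ δ : ENNReal, 0 < δ ∧ ∀ Φ Φ' : PeriodicTrialState N L,
        periodicEnergy v Φ ≤ periodicGroundStateEnergy v N L + δ →
        periodicEnergy v Φ' ≤ periodicGroundStateEnergy v N L + δ →
        ∃ θ : ℝ, ∫ X in cellN N L, ‖Φ.ψ X - Complex.exp (θ * Complex.I) * Φ'.ψ X‖ ^ 2 ≤ η)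
    {c : ℝ}
    (hocc : ∀ δ : ENNReal, 0 < δ → ∃ Ψ : PeriodicTrialState N L,
        periodicEnergy v Ψ ≤ periodicGroundStateEnergy v N L + δ ∧
        ENNReal.ofReal (c * N) ≤ condensateOccupation N L Ψ.ψ)
    {ε : ℝ} (hε : 0 < ε) :
    ∃ δ : ENNReal, 0 < δ ∧ ∀ Φ : PeriodicTrialState N L,
      periodicEnergy v Φ ≤ periodicGroundStateEnergy v N L + δ →
      ENNReal.ofReal ((c - ε) * N) ≤ condensateOccupation N L Φ.ψ :=
  le_condensateOccupation_nearMinimiser_of_clustering hL v hcl hocc hε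

end Summit.AtomisticToContinuum.BoseEinsteinCondensation.Cruxes.PolarTransferOS.Birth
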